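import Summits.AtomisticToContinuum.BoseEinsteinCondensation.Theorems.DensityResponse.Negative.ModeZeroEtaOrbital

/-!
# Negative lemmas for crux `DensityResponse` (stmt-AtomisticToContinuum-9481), VII: TIGHTNESS — the
# free gas forces `C ≥ 2`

Supports (does not close) stmt-AtomisticToContinuum-9481 (route `BECThomsonPrinciple`, rank 4); landed
copy of §11b of `Cruxes/DensityResponse/Disproof.lean` (generation 2, re-deriving generation 1's
finding (b) importably); `sorry`-free, standard axioms; no `Theses` decl asserted.

* `prodStateη` — the `η`-modulated product state `∏ᵢ c_η(1 + 2η cos θᵢ)`; `source_prodStateη`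
  (`= 4ηN/(1+2η²)`); `periodicEnergy_zero_prodStateη` — its EXACT free energy `2η²(2π/L)²N/(1+2η²)`
  (Fubini with one marked factor, `integral_cellN_marked`).
* `HoldsFree M ρ₀ C N₀` — the conclusion of the crux for `v = 0` with constant `C`;
  `holdsFree_four` (§9) and **`two_le_of_holdsFree : HoldsFree M ρ₀ C N₀ → 2 ≤ C`**: test at
  `L = M²N/(4π²)` (window equality), `n = e₀`, optimal tilt; the ratio source²k²/(4N·kinetic) is
  `2/(1+2η²) ↑ 2`.  So the free optimal constant lies in `[2, 4]` (Bogoliubov predicts `2`): a prover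
  must not hope for `C < 2`, and `C = 2 + o(1)` is what the interacting bound has to beat `ρa` with.
-/

noncomputable section

open MeasureTheory Set Filter Metric
open scoped ENNReal NNReal BigOperators Classical

namespace Summit.AtomisticToContinuum.BoseEinsteinCondensation.Theorems.DensityResponse.Negative

open Literature.MathematicalPhysics.QuantumManyBody.BoseGas

section Tightness

variable {N : ℕ} {L : ℝ}

/-! ### The `η`-product state, its source and its EXACT kinetic energy -/

/-- The product wave function `∏ᵢ φ_{η,L}(xᵢ)`. [folklore] -/
def prodFunη (η : ℝ) (N : ℕ) (L : ℝ) (X : Config N) : ℂ := ∏ i, orbη η L (X i)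

/-- The product is `C¹`. [folklore] -/
theorem contDiff_prodFunη (η : ℝ) (N : ℕ) (L : ℝ) : ContDiff ℝ 1 (prodFunη η N L) :=
  contDiff_prod fun i _ => ((contDiff_orbη η L).of_le le_top).comp
    (ContinuousLinearMap.proj (R := ℝ) (φ := fun _ => Space) i).contDiff

/-- The product is lattice periodic. [folklore] -/
theorem prodFunη_periodic (η : ℝ) (hL : L ≠ 0) (X : Config N) (i : Fin N) (k : Fin 3) :
    prodFunη η N L (X + Pi.single i (EuclideanSpace.single k L)) = prodFunη η N L X := by
  unfold prodFunη
  refine Finset.prod_congr rfl fun j _ => ?_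
  rw [Pi.add_apply]
  rcases eq_or_ne j i with rfl | hj
  · rw [Pi.single_eq_same, orbη_periodic η hL]
  · rw [Pi.single_eq_of_ne hj, add_zero]

/-- The product is Bose-symmetric. [folklore] -/
theorem prodFunη_symm (η : ℝ) (N : ℕ) (L : ℝ) (σ : Equiv.Perm (Fin N)) (X : Config N) :
    prodFunη η N L (X ∘ σ) = prodFunη η N L X := by
  unfold prodFunη
  exact Equiv.prod_comp σ (fun i => orbη η L (X i))

/-- `|∏φ|² = ∏|φ|²` in `ℝ≥0∞`. [folklore] -/
theorem nnnorm_prodFunη_sq (η : ℝ) (N : ℕ) (L : ℝ) (X : Config N) :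
    (‖prodFunη η N L X‖₊ : ℝ≥0∞) ^ 2 = ∏ i, (‖orbη η L (X i)‖₊ : ℝ≥0∞) ^ 2 := by
  rw [prodFunη, nnnorm_prod, ENNReal.ofNNReal_finsetProd, Finset.prod_pow]

/-- `|∏φ|² = ∏|φ|²`. [folklore] -/
theorem norm_prodFunη_sq (η : ℝ) (N : ℕ) (L : ℝ) (X : Config N) :
    ‖prodFunη η N L X‖ ^ 2 = ∏ i, ‖orbη η L (X i)‖ ^ 2 := by
  rw [prodFunη, norm_prod, Finset.prod_pow]

/-- The product is normalised (Tonelli). [folklore] -/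
theorem lintegral_cellN_prodFunη_sq (η : ℝ) (N : ℕ) (hL : 0 < L) :
    ∫⁻ X in cellN N L, (‖prodFunη η N L X‖₊ : ℝ≥0∞) ^ 2 = 1 := by
  simp_rw [nnnorm_prodFunη_sq]
  rw [volume_restrict_cellN, Literature.Probability.Distributions.lintegral_fin_nat_prod_eq_prod
    _ (fun _ x => (‖orbη η L x‖₊ : ℝ≥0∞) ^ 2) (fun _ => measurable_orbη_sq η L)]
  simp [lintegral_cell_orbη_sq η hL]

/-- **The `η`-modulated product state** on the torus. [folklore] -/
def prodStateη (η : ℝ) (N : ℕ) (hL : 0 < L) : PeriodicTrialState N L where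
  ψ := prodFunη η N L
  contDiff := contDiff_prodFunη η N L
  periodic := prodFunη_periodic η hL.ne'
  symm := prodFunη_symm η N L
  norm_eq := lintegral_cellN_prodFunη_sq η N hL

/-- The wave function of `prodStateη`. [folklore] -/
theorem prodStateη_ψ (η : ℝ) (N : ℕ) (hL : 0 < L) : (prodStateη η N hL).ψ = prodFunη η N L := rfl

/-- **Fubini with one marked factor**: `∫_{cellN} g(xᵢ) ∏_{j≠i} |φ(xⱼ)|² … = (∫_cell g)` when the
other factors integrate to `1`. [folklore] -/
theorem integral_cellN_marked (η : ℝ) (N : ℕ) (hL : 0 < L) {g : Space → ℝ} (hgc : Continuous g)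
    {M : ℝ} (hgM : ∀ x, ‖g x‖ ≤ M) (i : Fin N) :
    ∫ X in cellN N L, g (X i) * ∏ j ∈ Finset.univ.erase i, ‖orbη η L (X j)‖ ^ 2 = ∫ x in cell L, g x := by
  let f : Fin N → Space → ℝ := fun j => if j = i then g else fun x => ‖orbη η L x‖ ^ 2
  have hf : ∀ j, Integrable (f j) ((volume : Measure Space).restrict (cell L)) := by
    intro j
    by_cases h : j = i
    · simp only [f, if_pos h]; exact integrableOn_cell_of_bound hgc hgM L
    · simp only [f, if_neg h]; exact integrableOn_cell_norm_orbη_sq η hL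
  have hpt : ∀ X : Config N, g (X i) * ∏ j ∈ Finset.univ.erase i, ‖orbη η L (X j)‖ ^ 2 = ∏ j, f j (X j) := by
    intro X
    rw [← Finset.mul_prod_erase _ _ (Finset.mem_univ i)]
    simp only [f, if_true]
    congr 1
    exact Finset.prod_congr rfl fun j hj => by rw [if_neg (Finset.ne_of_mem_erase hj)]
  simp_rw [hpt]
  rw [volume_restrict_cellN, integral_fin_nat_prod_eq_prod]
  have hint : ∀ j, ∫ x in cell L, f j x = if j = i then ∫ x in cell L, g x else 1 := by
    intro j
    by_cases h : j = i
    · simp only [f, if_pos h]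
    · simp only [f, if_neg h]; exact integral_cell_norm_orbη_sq η hL
  simp_rw [hint]
  rw [Finset.prod_ite_eq' Finset.univ i]
  simp

/-- **Source of the `η`-state**: `∫ (∑ᵢ 2cos θᵢ)|Φ_η|² = 4ηN/(1+2η²)`. [folklore] -/
theorem source_prodStateη (η : ℝ) (N : ℕ) (hL : 0 < L) :
    ∫ X in cellN N L, (∑ i, 2 * Real.cos (θL L (X i))) * ‖(prodStateη η N hL).ψ X‖ ^ 2 =
      N * (4 * η / (1 + 2 * η ^ 2)) := by
  rw [prodStateη_ψ]
  have hpt : ∀ X : Config N, (∑ i, 2 * Real.cos (θL L (X i))) * ‖prodFunη η N L X‖ ^ 2 =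
      ∑ i, (2 * Real.cos (θL L (X i)) * ‖orbη η L (X i)‖ ^ 2) *
        ∏ j ∈ Finset.univ.erase i, ‖orbη η L (X j)‖ ^ 2 := by
    intro X
    rw [norm_prodFunη_sq, Finset.sum_mul]
    refine Finset.sum_congr rfl fun i _ => ?_
    rw [← Finset.mul_prod_erase _ _ (Finset.mem_univ i)]
    ring
  simp_rw [hpt]
  have hgc : Continuous fun x => 2 * Real.cos (θL L x) * ‖orbη η L x‖ ^ 2 :=
    (continuous_const.mul (Real.continuous_cos.comp (continuous_θL L))).mul ((continuous_orbη η L).norm.pow 2)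
  have hgM : ∀ x, ‖2 * Real.cos (θL L x) * ‖orbη η L x‖ ^ 2‖ ≤ 2 * (cη η L * (1 + 2 * |η|)) ^ 2 := by
    intro x
    rw [Real.norm_eq_abs, abs_mul, abs_mul, abs_of_nonneg (sq_nonneg ‖orbη η L x‖), abs_two]
    have h1 : |Real.cos (θL L x)| ≤ 1 := Real.abs_cos_le_one _
    have h2 : ‖orbη η L x‖ ^ 2 ≤ (cη η L * (1 + 2 * |η|)) ^ 2 :=
      pow_le_pow_left₀ (norm_nonneg _) (norm_orbη_le η hL x) 2
    calc 2 * |Real.cos (θL L x)| * ‖orbη η L x‖ ^ 2 ≤ 2 * 1 * (cη η L * (1 + 2 * |η|)) ^ 2 := by gcongr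
      _ = _ := by ring
  rw [integral_finsetSum _ fun i _ => ?_]
  · simp_rw [integral_cellN_marked η N hL hgc hgM, integral_cell_two_cos_norm_orbη_sq η hL]
    simp
  · refine integrableOn_cellN_of_continuous (f := fun X : Config N =>
      (2 * Real.cos (θL L (X i)) * ‖orbη η L (X i)‖ ^ 2) * ∏ j ∈ Finset.univ.erase i, ‖orbη η L (X j)‖ ^ 2) ?_ L
    exact (hgc.comp (continuous_apply i)).mul
      (continuous_finsetProd _ fun j _ => ((continuous_orbη η L).norm.pow 2).comp (continuous_apply j))

/-- The partial derivatives of the product. [folklore] -/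
theorem fderiv_prodFunη_unitVec (η : ℝ) (N : ℕ) (L : ℝ) (X : Config N) (i : Fin N) (k : Fin 3) :
    fderiv ℝ (prodFunη η N L) X (unitVec i k) =
      (∏ j ∈ Finset.univ.erase i, orbη η L (X j)) * fderiv ℝ (orbη η L) (X i) (EuclideanSpace.single k 1) := by
  have hdiff : ∀ j : Fin N, HasFDerivAt (fun Y : Config N => orbη η L (Y j))
      ((fderiv ℝ (orbη η L) (X j)).comp (ContinuousLinearMap.proj (R := ℝ) (φ := fun _ => Space) j)) X := by
    intro j
    exact ((hasFDerivAt_orbη η L (X j)).differentiableAt.hasFDerivAt).comp X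
      (ContinuousLinearMap.proj (R := ℝ) (φ := fun _ => Space) j).hasFDerivAt
  have hder := HasFDerivAt.finsetProd (u := Finset.univ) (g := fun j (Y : Config N) => orbη η L (Y j)) (x := X)
    fun j _ => hdiff j
  rw [show prodFunη η N L = fun Y => ∏ j ∈ Finset.univ, orbη η L (Y j) from rfl, hder.fderiv,
    FunLike.coe_sum, Finset.sum_apply, Finset.sum_eq_single i]
  · rw [smul_apply, ContinuousLinearMap.comp_apply, ContinuousLinearMap.proj_apply]
    simp only [unitVec, Pi.single_eq_same, smul_eq_mul]
  · intro j _ hji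
    rw [smul_apply, ContinuousLinearMap.comp_apply, ContinuousLinearMap.proj_apply]
    simp only [unitVec, Pi.single_eq_of_ne hji, map_zero, smul_zero]
  · intro h; exact absurd (Finset.mem_univ i) h

/-- **EXACT kinetic energy of the `η`-state**: `E₀-free energy = 2η²(2π/L)²N/(1+2η²)`. [folklore] -/
theorem periodicEnergy_zero_prodStateη (η : ℝ) (N : ℕ) (hL : 0 < L) :
    periodicEnergy 0 (prodStateη η N hL) =
      ENNReal.ofReal (N * (2 * η ^ 2 * (2 * Real.pi / L) ^ 2 / (1 + 2 * η ^ 2))) := by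
  rw [periodicEnergy_zero_eq, prodStateη_ψ]
  have hk0 : ∀ (i : Fin N) (X : Config N), (‖fderiv ℝ (prodFunη η N L) X (unitVec i 0)‖₊ : ℝ≥0∞) ^ 2 =
      ENNReal.ofReal (‖fderiv ℝ (orbη η L) (X i) (EuclideanSpace.single 0 1)‖ ^ 2 *
        ∏ j ∈ Finset.univ.erase i, ‖orbη η L (X j)‖ ^ 2) := by
    intro i X
    rw [ennnorm_sq_eq, fderiv_prodFunη_unitVec, norm_mul, mul_pow, norm_prod, Finset.prod_pow, mul_comm]
  have hk1 : ∀ (i : Fin N) (X : Config N) (k : Fin 3), (0 : Fin 3) ≠ k →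
      (‖fderiv ℝ (prodFunη η N L) X (unitVec i k)‖₊ : ℝ≥0∞) ^ 2 = 0 := by
    intro i X k hk
    rw [fderiv_prodFunη_unitVec, fderiv_orbη_single_of_ne η L (X i) hk, mul_zero]
    simp
  have hpt : ∀ X : Config N, kineticDensity (prodFunη η N L) X =
      ∑ i, ENNReal.ofReal (‖fderiv ℝ (orbη η L) (X i) (EuclideanSpace.single 0 1)‖ ^ 2 *
        ∏ j ∈ Finset.univ.erase i, ‖orbη η L (X j)‖ ^ 2) := by
    intro X
    unfold kineticDensity
    refine Finset.sum_congr rfl fun i _ => ?_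
    rw [Fin.sum_univ_three, hk0, hk1 i X 1 (by decide), hk1 i X 2 (by decide), add_zero, add_zero]
  simp_rw [hpt]
  have hgc : Continuous fun x => ‖fderiv ℝ (orbη η L) x (EuclideanSpace.single 0 1)‖ ^ 2 := by
    simp_rw [norm_fderiv_orbη_single_zero_sq]
    exact continuous_const.mul ((Real.continuous_sin.comp (continuous_θL L)).pow 2)
  have hgM : ∀ x, ‖‖fderiv ℝ (orbη η L) x (EuclideanSpace.single 0 1)‖ ^ 2‖ ≤
      cη η L ^ 2 * (4 * η ^ 2 * (2 * Real.pi / L) ^ 2) * 1 := by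
    intro x
    rw [Real.norm_eq_abs, abs_of_nonneg (sq_nonneg _), norm_fderiv_orbη_single_zero_sq]
    gcongr
    rw [sq_le_one_iff_abs_le_one]
    exact Real.abs_sin_le_one _
  have hcont : ∀ i : Fin N, Continuous fun X : Config N =>
      ‖fderiv ℝ (orbη η L) (X i) (EuclideanSpace.single 0 1)‖ ^ 2 * ∏ j ∈ Finset.univ.erase i, ‖orbη η L (X j)‖ ^ 2 :=
    fun i => (hgc.comp (continuous_apply i)).mul
      (continuous_finsetProd _ fun j _ => ((continuous_orbη η L).norm.pow 2).comp (continuous_apply j))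
  rw [lintegral_finsetSum _ fun i _ => (hcont i).measurable.ennreal_ofReal]
  have hterm : ∀ i : Fin N, ∫⁻ X in cellN N L, ENNReal.ofReal (‖fderiv ℝ (orbη η L) (X i) (EuclideanSpace.single 0 1)‖ ^ 2 *
      ∏ j ∈ Finset.univ.erase i, ‖orbη η L (X j)‖ ^ 2) =
      ENNReal.ofReal (2 * η ^ 2 * (2 * Real.pi / L) ^ 2 / (1 + 2 * η ^ 2)) := by
    intro i
    rw [← ofReal_integral_eq_lintegral_ofReal (integrableOn_cellN_of_continuous (hcont i) L)
      (ae_of_all _ fun X => mul_nonneg (sq_nonneg _) (Finset.prod_nonneg fun j _ => sq_nonneg _)),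
      integral_cellN_marked η N hL hgc hgM, integral_cell_norm_fderiv_orbη_sq η hL]
  simp_rw [hterm]
  rw [Finset.sum_const, Finset.card_univ, Fintype.card_fin, nsmul_eq_mul, ← ENNReal.ofReal_natCast,
    ← ENNReal.ofReal_mul (Nat.cast_nonneg _)]

/-- The inner conclusion of the crux for the free gas with constant `C` (`a(0) = 0` written out). -/
def HoldsFree (M ρ₀ C : ℝ) (N₀ : ℕ) : Prop :=
  ∀ N : ℕ, N₀ ≤ N → ∀ L : ℝ, 0 < L → (N : ℝ) ≤ ρ₀ * L ^ 3 → ∀ n : Fin 3 → ℤ, n ≠ 0 →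
    2 * Real.pi * ‖(fun j => (n j : ℝ))‖ / L ≤ M * Real.sqrt (N / L ^ 3) → ∀ s : ℝ, 0 ≤ s →
    ∀ Φ : PeriodicTrialState N L,
      periodicGroundStateEnergy 0 N L + ENNReal.ofReal (s * |∫ X in cellN N L,
        (∑ i, 2 * Real.cos (2 * Real.pi / L * ∑ j, (n j : ℝ) * X i j)) * ‖Φ.ψ X‖ ^ 2|) ≤
      periodicEnergy 0 Φ + ENNReal.ofReal (C * s ^ 2 * N /
        ((2 * Real.pi * ‖(fun j => (n j : ℝ))‖ / L) ^ 2 + N / L ^ 3 * (scatteringLength 0).toReal))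

/-- `holds_free_four` in this notation. [folklore] -/
theorem holdsFree_four (M ρ₀ : ℝ) (N₀ : ℕ) : HoldsFree M ρ₀ 4 N₀ := holds_free_four M ρ₀ N₀

/-- **TIGHTNESS (gen 1 (b)): for the free gas every admissible constant is at least `2`.**
If the conclusion of `DensityResponse` holds for `v = 0` with constants `(M, ρ₀, C, N₀)`, then
`2 ≤ C`: test the chord on the `η`-modulated product states at `L = M²N/(4π²)` (window equality,
`N` large enough for diluteness), `n = e₀`, optimal tilt; the ratio source²·k²/(4N·kinetic) is
`2/(1+2η²) ↑ 2` as `η ↓ 0`.  Hence the free optimal constant lies in `[2, 4]`. [folklore] -/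
theorem two_le_of_holdsFree {M ρ₀ C : ℝ} (hM : 0 < M) (hρ₀ : 0 < ρ₀) (hC : 0 < C) {N₀ : ℕ}
    (h : HoldsFree M ρ₀ C N₀) : 2 ≤ C := by
  by_contra hlt
  push Not at hlt
  -- a small modulation with `C (1 + 2η²) < 2`
  obtain ⟨η, hη0, hηC⟩ : ∃ η : ℝ, 0 < η ∧ C * (1 + 2 * η ^ 2) < 2 := by
    refine ⟨min (1 / 2) ((2 - C) / (4 * C)), by positivity, ?_⟩
    have h1 : min (1 / 2) ((2 - C) / (4 * C)) ≤ (2 - C) / (4 * C) := min_le_right _ _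
    have h2 : min (1 / 2) ((2 - C) / (4 * C)) ≤ 1 / 2 := min_le_left _ _
    have h3 : 0 < min (1 / 2) ((2 - C) / (4 * C)) := by positivity
    have h4 : (min (1 / 2) ((2 - C) / (4 * C))) ^ 2 ≤ (2 - C) / (4 * C) * (1 / 2) := by
      rw [sq]; exact mul_le_mul h1 h2 h3.le (by positivity)
    have h5 : C * (2 * ((2 - C) / (4 * C) * (1 / 2))) = (2 - C) / 4 := by field_simp
    nlinarith
  -- a large particle number: window equality `L = M²N/(4π²)` and diluteness `N ≤ ρ₀L³`
  obtain ⟨N, hN0, hN1, hNbig⟩ : ∃ N : ℕ, N₀ ≤ N ∧ 1 ≤ N ∧ (4 * Real.pi ^ 2) ^ 3 / (ρ₀ * M ^ 6) ≤ N := by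
    obtain ⟨m, hm⟩ := exists_nat_ge ((4 * Real.pi ^ 2) ^ 3 / (ρ₀ * M ^ 6))
    exact ⟨max (max N₀ 1) m, (le_max_left _ _).trans (le_max_left _ _),
      (le_max_right _ _).trans (le_max_left _ _), hm.trans (by exact_mod_cast le_max_right _ _)⟩
  have hN1r : (1 : ℝ) ≤ N := by exact_mod_cast hN1
  have hπ := Real.pi_pos
  obtain ⟨L, hL_def⟩ : ∃ L : ℝ, L = M ^ 2 * N / (4 * Real.pi ^ 2) := ⟨_, rfl⟩
  have hL : 0 < L := by rw [hL_def]; positivity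
  have hdil : (N : ℝ) ≤ ρ₀ * L ^ 3 := by
    rw [hL_def]
    rw [div_le_iff₀ (by positivity)] at hNbig
    have key : (N : ℝ) * (4 * Real.pi ^ 2) ^ 3 ≤ ρ₀ * (M ^ 2 * N) ^ 3 := by
      calc (N : ℝ) * (4 * Real.pi ^ 2) ^ 3 ≤ N * (N * (ρ₀ * M ^ 6)) := by gcongr
        _ ≤ N * (N * (ρ₀ * M ^ 6)) * N := le_mul_of_one_le_right (by positivity) hN1r
        _ = ρ₀ * (M ^ 2 * N) ^ 3 := by ring
    rw [div_pow, mul_div_assoc', le_div_iff₀ (by positivity)]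
    exact key
  -- the mode `n = e₀`
  obtain ⟨n, hn_def⟩ : ∃ n : Fin 3 → ℤ, n = Pi.single 0 1 := ⟨_, rfl⟩
  have hn : n ≠ 0 := by
    intro h0; have := congr_fun h0 0; simp [hn_def] at this
  have hnorm : ‖(fun j => (n j : ℝ))‖ = 1 := by
    have : (fun j => (n j : ℝ)) = Pi.single (0 : Fin 3) (1 : ℝ) := by
      funext j; simp only [hn_def, Pi.single_apply]; split_ifs <;> simp
    rw [this, Pi.norm_single, norm_one]
  have hphase : ∀ x : Space, 2 * Real.pi / L * ∑ j, (n j : ℝ) * x j = θL L x := by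
    intro x; simp [hn_def, Pi.single_apply, θL]
  have hwin : 2 * Real.pi * ‖(fun j => (n j : ℝ))‖ / L ≤ M * Real.sqrt (N / L ^ 3) := by
    rw [hnorm, mul_one]
    have hsq : (2 * Real.pi / L) ^ 2 = M ^ 2 * (N / L ^ 3) := by
      rw [hL_def]; field_simp; ring
    have : 2 * Real.pi / L = M * Real.sqrt (N / L ^ 3) := by
      rw [← Real.sqrt_sq (by positivity : (0 : ℝ) ≤ 2 * Real.pi / L), hsq,
        Real.sqrt_mul (sq_nonneg _), Real.sqrt_sq hM.le]
    exact this.le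
  -- the test: source `A`, kinetic energy `B`, optimal tilt `s`
  obtain ⟨q, hq_def⟩ : ∃ q : ℝ, q = (2 * Real.pi / L) ^ 2 := ⟨_, rfl⟩
  have hq : 0 < q := by rw [hq_def]; positivity
  obtain ⟨A, hA_def⟩ : ∃ A : ℝ, A = N * (4 * η / (1 + 2 * η ^ 2)) := ⟨_, rfl⟩
  have hA0 : 0 < A := by rw [hA_def]; positivity
  obtain ⟨s, hs_def⟩ : ∃ s : ℝ, s = A * q / (2 * C * N) := ⟨_, rfl⟩
  have hs : 0 ≤ s := by rw [hs_def]; positivity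
  have key := h N hN0 L hL hdil n hn hwin s hs (prodStateη η N hL)
  have hsrc : ∫ X in cellN N L, (∑ i, 2 * Real.cos (2 * Real.pi / L * ∑ j, (n j : ℝ) * X i j)) *
      ‖(prodStateη η N hL).ψ X‖ ^ 2 = A := by
    simp_rw [hphase]; rw [hA_def]; exact source_prodStateη η N hL
  have hden : (2 * Real.pi * ‖(fun j => (n j : ℝ))‖ / L) ^ 2 + N / L ^ 3 * (scatteringLength 0).toReal = q := by
    rw [hnorm, mul_one, scatteringLength_zero, ENNReal.toReal_zero, mul_zero, add_zero, hq_def]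
  rw [hsrc, hden, periodicGroundStateEnergy_zero N hL, zero_add, periodicEnergy_zero_prodStateη,
    ← hq_def, abs_of_pos hA0, ← ENNReal.ofReal_add (by positivity) (by positivity),
    ENNReal.ofReal_le_ofReal_iff (by positivity)] at key
  -- `s A ≤ B + C s² N/q` contradicts `C(1+2η²) < 2`
  have hNp : (0 : ℝ) < N := by linarith
  have hp : 0 < 1 + 2 * η ^ 2 := by positivity
  have h1 : s * A - C * s ^ 2 * N / q = A ^ 2 * q / (4 * C * N) := by
    rw [hs_def]; field_simp; ring
  have h2 : (N : ℝ) * (2 * η ^ 2 * q / (1 + 2 * η ^ 2)) < A ^ 2 * q / (4 * C * N) := by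
    rw [hA_def, lt_div_iff₀ (by positivity)]
    have e1 : (N : ℝ) * (2 * η ^ 2 * q / (1 + 2 * η ^ 2)) * (4 * C * N) =
        (8 * η ^ 2 * q * N ^ 2) * (C / (1 + 2 * η ^ 2)) := by
      field_simp
      ring
    have e2 : ((N : ℝ) * (4 * η / (1 + 2 * η ^ 2))) ^ 2 * q =
        (8 * η ^ 2 * q * N ^ 2) * (2 / (1 + 2 * η ^ 2) ^ 2) := by
      field_simp
      ring
    rw [e1, e2]
    refine mul_lt_mul_of_pos_left ?_ (by positivity)
    rw [div_lt_div_iff₀ hp (by positivity)]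
    nlinarith
  linarith

end Tightness


/-- No constant below `2` works for the free gas (gen 1 (c)). [folklore] -/
theorem not_holdsFree_of_lt_two {M ρ₀ C : ℝ} (hM : 0 < M) (hρ₀ : 0 < ρ₀) (hC : 0 < C) (hC2 : C < 2)
    {N₀ : ℕ} : ¬ HoldsFree M ρ₀ C N₀ := fun h => absurd (two_le_of_holdsFree hM hρ₀ hC h) (not_le.2 hC2)

/-- **The chord over all tilts is a square-root bound** (gen 1's `forall_chord_iff`, real core):
for `A ≥ 0`, `D > 0` (and any `B`), `(∀ s ≥ 0, sA ≤ B + Ds²) ↔ A² ≤ 4BD`.  With `A = |⟨V_k⟩_Φ|`,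
`B = E(Φ) − E₀`, `D = CN/(k∞² + ρa)` this is `|⟨V_k⟩_Φ|² ≤ 4CN(E(Φ) − E₀)/(k∞² + ρa)`, i.e. the
static response bound `χ(k) ≤ 2CN/(k² + ρa)`. [folklore] -/
theorem forall_tilt_iff_sq_le {A B D : ℝ} (hA : 0 ≤ A) (hD : 0 < D) :
    (∀ s : ℝ, 0 ≤ s → s * A ≤ B + D * s ^ 2) ↔ A ^ 2 ≤ 4 * B * D := by
  constructor
  · intro h
    have := h (A / (2 * D)) (by positivity)
    have e : A / (2 * D) * A - D * (A / (2 * D)) ^ 2 = A ^ 2 / (4 * D) := by field_simp; ring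
    rw [← sub_le_iff_le_add, e, div_le_iff₀ (by positivity)] at this
    linarith
  · intro h s _
    nlinarith [sq_nonneg (2 * D * s - A), hD]

end Summit.AtomisticToContinuum.BoseEinsteinCondensation.Theorems.DensityResponse.Negative

end
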